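/-
Copyright (c) 2026 the pub-hodgecm-mathlib formalisation cell (harness21).  Prover seat hodgecm-mathlib-K2E4-p23 (g2), Track B ∕ K2-LIT, h413 =
`stmt-HodgeConjecture-24833`, ENGINE E1, 5Res campaign, deal (113) «first half of the `hmc` payer» of the dealer K2E1-plan (g6) 2026-09-04T11:00:58Z, part (i):
the SINGLE-PLACE archimedean torus and circle families of `U(1,1)_{L∕L⁺}` — DEFINITIONS (+ trivial API).
-/
import Literature.NumberTheory.Automorphic.UnitaryGroupArchSection      -- ★ `adelicSingle w : archLocal →* U(J)(𝔸)` (single-place inclusion), `archLocal`, `commute_adelicSingle_of_mem_awayFrom`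
import Literature.NumberTheory.Automorphic.UnitaryGroupArchimedean       -- ★ `complexConj_smul_infinitePlace`
import Mathlib.Analysis.SpecialFunctions.Complex.Circle
import HarnessLib

/-!
# K2·E1 — `K2E1ArchTorusFamilyU11Defs`: THE SPLIT TORUS `t_w(a) = diag(a, a⁻¹)` AND THE CIRCLE `k_w(u,v) = ((u+v)∕2 (u−v)∕2; (u−v)∕2 (u+v)∕2)` OF `U(1,1)(ℝ)`
# AT ONE COMPLEX PLACE `w`, AS ELEMENTS OF `U(J₂)(𝔸_{L⁺})` (deal (113) part (i) — the group elements along which the `hmc` matrix coefficient is read)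

Track B ∕ K2-LIT, crux h413 = `stmt-HodgeConjecture-24833`, route of record `HCCMUnconditional`; cell `hodgecm-mathlib`, squad K2, ENGINE E1 (5Res campaign, ARCH-UNITARITY leg).
Prover seat `hodgecm-mathlib-K2E4-p23` (g2); deal (113) of the dealer K2E1-plan (g6).  DEFINITIONS WITH BODIES + trivial API (no `instance`, no notation, no named-fact hypothesis, no
`sorry`); lane `--kind definition --supports stmt-HodgeConjecture-24833 --as helper` (reviewed).  CLOSES NO SOCKET.

THE OBJECTS.  `L` a CM field, `L⁺` its maximal real subfield, `c` = complex conjugation (★ `IsCMField.complexConj_ne_one`, ★ `complexConj_smul_infinitePlace`), `J₂` = Mok's antidiagonal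
form; at a complex place `w` of `L` the local group is `archLocal L 2 J₂ w = {g ∈ GL₂(ℂ) : gᴴ J₂ g = J₂} = U(1,1)` (★ `mem_archLocal_iff_conjTranspose`; `J₂ ↦ !![0,1;1,0]`, §0), and
★ `adelicSingle w : archLocal →* U(J₂)(𝔸_{L⁺})` is the single-place inclusion `u ↦ ((u at w, 1 at w′ ≠ w), 1_f)`.  We define
* §1 **`torusLoc w u := diag(e^u, e^{−u})`** (`u : ℝ`; a continuous homomorphism `ℝ →+ U(1,1)`, `torusLoc_add`, `torusLoc_neg`) and **`circleLoc w u v := ((u+v)∕2 (u−v)∕2; (u−v)∕2 (u+v)∕2)`**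
  (`u v : Circle`; the compact torus `K_w = U(J₂) ∩ U(2) ≅ U(1) × U(1)` of ★ `K2E1ArchComponentKTypeU2`: `k = (a b; b a)`, `a ± b = u, v`; `circleLoc_mul`, `circleLoc_one`), the WEYL
  ELEMENT `circleLoc w 1 (−1) = !![0,1;1,0]` with `weyl·diag(e^u,e^{−u})·weyl⁻¹ = diag(e^{−u}, e^u)` (`circleLoc_weyl_mul_torusLoc_mul`);
* §2 the adelic families **`torusAt w a := adelicSingle w (torusLoc w (log a))`** (`a > 0`: `= diag(a, a⁻¹)` at `w`; `torusAt_mul`, **`torusAt_inv : torusAt w a⁻¹ = (torusAt w a)⁻¹`** —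
  the `ht` binder of ★ `arch_unitarity_of_matrixCoeff`) and **`circleAt w u v := adelicSingle w (circleLoc w u v)`** (`circleAt_mul`, the Weyl conjugation `circleAt_weyl_conj_torusAt`).
USE (FILE (ii) `K2E1ArchTorusActionFlatSectionU11`): the one-parameter average `(2π)⁻¹ ∫₀^{2π} e^{−iqθ} f_z(g · circleAt w 1 (Circle.exp θ) · torusAt w a) dθ` IS the `κ`-isotypic matrix
coefficient `archTorusCoeff (z + it_w) (p − q) a · f_z(g)` (★ `K2E1ArchTorusCoefficientU11Defs`) for a `χ`-section of `K_w`-type `(p, q)` — no `K_∞`-Haar projector needed.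
HONEST LABEL: HC_CM is proved only modulo the 7 printed citations (2 remaining named inputs: hLiu418 = `stmt-HodgeConjecture-24832`, h413 = `stmt-HodgeConjecture-24833`) until rung 0
closes; this file defines group elements, asserts no named fact and closes no socket; count-neutral.

## References
* [BorelJacquet1979] A. Borel, H. Jacquet, *Automorphic forms and automorphic representations*, PSPM 33.1 (1979), §4.1 (`G(𝔸) = G_∞ × G(𝔸_f)`, factor inclusions).
* [Knapp1986] A. W. Knapp, *Representation Theory of Semisimple Groups* (1986), VII §1 (`SU(1,1)`, `K`, `A`, the Weyl element).
* [Garrett2018] P. Garrett, *Modern Analysis of Automorphic Forms by Example* 1 (2018), §2.2 (`U(1,1)`: Iwasawa coordinates and `K`-types).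
-/

set_option autoImplicit false
-- the mandated namespace repeats the single-problem summit's segment (`HodgeConjecture.HodgeConjecture`)
set_option linter.dupNamespace false

noncomputable section

open NumberField NumberField.InfinitePlace Matrix
open scoped MatrixGroups ComplexConjugate
open Literature.NumberTheory.Automorphic Literature.NumberTheory.Automorphic.UnitaryGroup

namespace Summit.HodgeConjecture.HodgeConjecture.Cruxes.H413.K2E1ArchTorusFamilyU11Defs

variable (L : Type) [Field L] (w : {w : InfinitePlace L // IsComplex w})

/-! ## §0 The local form at a complex place is `!![0, 1; 1, 0]` -/

/-- `σ_w(J₂) = !![0, 1; 1, 0]` as a complex matrix. [folklore] -/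
theorem localForm_eq : ((StdForm.antidiagonal 2).over L).map w.1.embedding = !![(0 : ℂ), 1; 1, 0] := by
  rw [StdForm.over_map]
  ext i j
  fin_cases i <;> fin_cases j <;> simp [StdForm.over, StdForm.antidiagonal_J_apply]

/-- Membership in `U(1,1) = archLocal L 2 J₂ w` for an explicit matrix: `gᴴ·!![0,1;1,0]·g = !![0,1;1,0]`. [folklore] -/
theorem mem_archLocal_two_iff (g : GL (Fin 2) ℂ) :
    g ∈ archLocal L 2 ((StdForm.antidiagonal 2).over L) w ↔ (g : Matrix (Fin 2) (Fin 2) ℂ)ᴴ * !![(0 : ℂ), 1; 1, 0] * (g : Matrix (Fin 2) (Fin 2) ℂ) = !![(0 : ℂ), 1; 1, 0] := by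
  rw [mem_archLocal_iff_conjTranspose, localForm_eq]

/-! ## §1 The local one-parameter torus and the local circle of `U(1,1)(ℝ)` -/

/-- The matrix `diag(e^u, e^{−u})`. [cite: Knapp1986, VII §1] -/
def torusLocMatrix (u : ℝ) : Matrix (Fin 2) (Fin 2) ℂ := !![((Real.exp u : ℝ) : ℂ), 0; 0, ((Real.exp (-u) : ℝ) : ℂ)]

/-- `det diag(e^u, e^{−u}) = 1`. [folklore] -/
theorem det_torusLocMatrix (u : ℝ) : (torusLocMatrix u).det = 1 := by
  rw [torusLocMatrix, Matrix.det_fin_two_of, ← Complex.ofReal_mul, ← Real.exp_add, add_neg_cancel, Real.exp_zero]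
  simp

/-- `diag(e^u, e^{−u}) ∈ U(1,1)`: `e^u` is real, `e^u·e^{−u} = 1`. [cite: Knapp1986, VII §1] -/
theorem torusLocMatrix_mem (u : ℝ) :
    Matrix.GeneralLinearGroup.mkOfDetNeZero (torusLocMatrix u) (by rw [det_torusLocMatrix]; exact one_ne_zero) ∈
      archLocal L 2 ((StdForm.antidiagonal 2).over L) w := by
  rw [mem_archLocal_two_iff]
  have h1 : (starRingEnd ℂ) (Complex.exp (u : ℂ)) * Complex.exp (-(u : ℂ)) = 1 := by
    rw [← Complex.exp_conj, Complex.conj_ofReal, ← Complex.exp_add, add_neg_cancel, Complex.exp_zero]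
  have h2 : (starRingEnd ℂ) (Complex.exp (-(u : ℂ))) * Complex.exp (u : ℂ) = 1 := by
    rw [← Complex.exp_conj, map_neg, Complex.conj_ofReal, ← Complex.exp_add, neg_add_cancel, Complex.exp_zero]
  show (torusLocMatrix u)ᴴ * !![(0 : ℂ), 1; 1, 0] * torusLocMatrix u = !![(0 : ℂ), 1; 1, 0]
  rw [torusLocMatrix, Matrix.conjTranspose, Matrix.transpose]
  ext i j
  fin_cases i <;> fin_cases j <;> simp [Matrix.mul_apply, Fin.sum_univ_two, h1, h2]

/-- **`torusLoc w u := diag(e^u, e^{−u}) ∈ U(1,1)` at the complex place `w`** (`u : ℝ`; `a = e^u > 0` is the torus parameter of the 5Res map). [cite: Knapp1986, VII §1] -/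
def torusLoc (u : ℝ) : archLocal L 2 ((StdForm.antidiagonal 2).over L) w :=
  ⟨Matrix.GeneralLinearGroup.mkOfDetNeZero (torusLocMatrix u) (by rw [det_torusLocMatrix]; exact one_ne_zero), torusLocMatrix_mem L w u⟩

/-- The matrix of `torusLoc w u`. [folklore] -/
@[simp] theorem coe_torusLoc (u : ℝ) :
    (((torusLoc L w u : archLocal L 2 ((StdForm.antidiagonal 2).over L) w) : GL (Fin 2) ℂ) : Matrix (Fin 2) (Fin 2) ℂ) = torusLocMatrix u := rfl

/-- `torusLoc 0 = 1`. [folklore] -/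
theorem torusLoc_zero : torusLoc L w 0 = 1 := by
  apply Subtype.ext
  apply Matrix.GeneralLinearGroup.ext
  intro i j
  rw [coe_torusLoc, torusLocMatrix]
  fin_cases i <;> fin_cases j <;> simp

/-- **`torusLoc (u + u′) = torusLoc u · torusLoc u′`** (a one-parameter subgroup). [cite: Knapp1986, VII §1] -/
theorem torusLoc_add (u u' : ℝ) : torusLoc L w (u + u') = torusLoc L w u * torusLoc L w u' := by
  apply Subtype.ext
  apply Matrix.GeneralLinearGroup.ext
  intro i j
  change torusLocMatrix (u + u') i j = (torusLocMatrix u * torusLocMatrix u') i j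
  rw [torusLocMatrix, torusLocMatrix, torusLocMatrix, neg_add, Real.exp_add, Real.exp_add]
  fin_cases i <;> fin_cases j <;> simp [Matrix.mul_apply, Fin.sum_univ_two]

/-- `torusLoc (−u) = (torusLoc u)⁻¹`. [folklore] -/
theorem torusLoc_neg (u : ℝ) : torusLoc L w (-u) = (torusLoc L w u)⁻¹ := by
  rw [eq_inv_iff_mul_eq_one, ← torusLoc_add, neg_add_cancel, torusLoc_zero]

/-- `u ↦ torusLoc w u` is continuous. [folklore] -/
theorem continuous_torusLoc : Continuous (torusLoc L w) := by
  refine Continuous.subtype_mk ?_ _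
  refine Units.continuous_iff.2 ⟨?_, ?_⟩
  · refine continuous_matrix fun i j => ?_
    fin_cases i <;> fin_cases j <;> simp [torusLocMatrix] <;> fun_prop
  · have h : ∀ u : ℝ, ((Matrix.GeneralLinearGroup.mkOfDetNeZero (torusLocMatrix u) (by rw [det_torusLocMatrix]; exact one_ne_zero))⁻¹ : GL (Fin 2) ℂ) =
        Matrix.GeneralLinearGroup.mkOfDetNeZero (torusLocMatrix (-u)) (by rw [det_torusLocMatrix]; exact one_ne_zero) := fun u => by
      have := torusLoc_neg L w u
      rw [Subtype.ext_iff, Subgroup.coe_inv] at this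
      exact this.symm
    simp_rw [h]
    refine continuous_matrix fun i j => ?_
    fin_cases i <;> fin_cases j <;> simp [torusLocMatrix] <;> fun_prop

/-- The matrix `((u+v)∕2 (u−v)∕2; (u−v)∕2 (u+v)∕2)` of the local circle. [cite: Garrett2018, §2.2] -/
def circleLocMatrix (u v : Circle) : Matrix (Fin 2) (Fin 2) ℂ :=
  !![((u : ℂ) + v) / 2, ((u : ℂ) - v) / 2; ((u : ℂ) - v) / 2, ((u : ℂ) + v) / 2]

/-- `det circleLocMatrix u v = u·v ≠ 0`. [folklore] -/
theorem det_circleLocMatrix (u v : Circle) : (circleLocMatrix u v).det = (u : ℂ) * v := by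
  rw [circleLocMatrix, Matrix.det_fin_two_of]
  ring

/-- `det ≠ 0`. [folklore] -/
theorem det_circleLocMatrix_ne_zero (u v : Circle) : (circleLocMatrix u v).det ≠ 0 := by
  rw [det_circleLocMatrix]
  exact mul_ne_zero (Circle.coe_ne_zero u) (Circle.coe_ne_zero v)

/-- `((u+v)∕2 (u−v)∕2; (u−v)∕2 (u+v)∕2) ∈ U(1,1)` for `|u| = |v| = 1` (it is the unitary matrix with eigenvalues `u, v` on `e₀ ± e₁`, and these eigenlines are `J₂`-isotropic-orthogonal).
[cite: Garrett2018, §2.2] -/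
theorem circleLocMatrix_mem (u v : Circle) :
    Matrix.GeneralLinearGroup.mkOfDetNeZero (circleLocMatrix u v) (det_circleLocMatrix_ne_zero u v) ∈ archLocal L 2 ((StdForm.antidiagonal 2).over L) w := by
  rw [mem_archLocal_two_iff]
  have hu : (starRingEnd ℂ) (u : ℂ) * u = 1 := by rw [mul_comm, Complex.mul_conj, Circle.normSq_coe, Complex.ofReal_one]
  have hv : (starRingEnd ℂ) (v : ℂ) * v = 1 := by rw [mul_comm, Complex.mul_conj, Circle.normSq_coe, Complex.ofReal_one]
  have hu' : (starRingEnd ℂ) (u : ℂ) = (u : ℂ)⁻¹ := (Circle.coe_inv_eq_conj u).symm.trans (Circle.coe_inv u)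
  have hv' : (starRingEnd ℂ) (v : ℂ) = (v : ℂ)⁻¹ := (Circle.coe_inv_eq_conj v).symm.trans (Circle.coe_inv v)
  have hu0 : (u : ℂ) ≠ 0 := Circle.coe_ne_zero u
  have hv0 : (v : ℂ) ≠ 0 := Circle.coe_ne_zero v
  show (circleLocMatrix u v)ᴴ * !![(0 : ℂ), 1; 1, 0] * circleLocMatrix u v = !![(0 : ℂ), 1; 1, 0]
  rw [circleLocMatrix, Matrix.conjTranspose, Matrix.transpose]
  ext i j
  fin_cases i <;> fin_cases j <;>
    · simp [Matrix.mul_apply, Fin.sum_univ_two, map_add, map_sub, map_div₀, map_ofNat, hu', hv']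
      field_simp
      ring

/-- **`circleLoc w u v ∈ K_w = U(1,1) ∩ U(2)`** at the complex place `w` (`u v : Circle`; the element `(a b; b a)` with `a + b = u`, `a − b = v` of ★ `K2E1ArchComponentKTypeU2`). [cite: Garrett2018, §2.2] -/
def circleLoc (u v : Circle) : archLocal L 2 ((StdForm.antidiagonal 2).over L) w :=
  ⟨Matrix.GeneralLinearGroup.mkOfDetNeZero (circleLocMatrix u v) (det_circleLocMatrix_ne_zero u v), circleLocMatrix_mem L w u v⟩

/-- The matrix of `circleLoc w u v`. [folklore] -/
@[simp] theorem coe_circleLoc (u v : Circle) :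
    (((circleLoc L w u v : archLocal L 2 ((StdForm.antidiagonal 2).over L) w) : GL (Fin 2) ℂ) : Matrix (Fin 2) (Fin 2) ℂ) = circleLocMatrix u v := rfl

/-- `circleLoc 1 1 = 1`. [folklore] -/
theorem circleLoc_one : circleLoc L w 1 1 = 1 := by
  apply Subtype.ext
  apply Matrix.GeneralLinearGroup.ext
  intro i j
  rw [coe_circleLoc, circleLocMatrix]
  fin_cases i <;> fin_cases j <;> simp

/-- **`circleLoc (u u′) (v v′) = circleLoc u v · circleLoc u′ v′`** (`K_w` is abelian; `(u, v)` are the eigenvalue coordinates). [cite: Garrett2018, §2.2] -/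
theorem circleLoc_mul (u u' v v' : Circle) : circleLoc L w (u * u') (v * v') = circleLoc L w u v * circleLoc L w u' v' := by
  apply Subtype.ext
  apply Matrix.GeneralLinearGroup.ext
  intro i j
  change circleLocMatrix (u * u') (v * v') i j = (circleLocMatrix u v * circleLocMatrix u' v') i j
  rw [circleLocMatrix, circleLocMatrix, circleLocMatrix, Circle.coe_mul, Circle.coe_mul]
  fin_cases i <;> fin_cases j <;>
    · simp [Matrix.mul_apply, Fin.sum_univ_two]
      ring

/-- `circleLoc u⁻¹ v⁻¹ = (circleLoc u v)⁻¹`. [folklore] -/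
theorem circleLoc_inv (u v : Circle) : circleLoc L w u⁻¹ v⁻¹ = (circleLoc L w u v)⁻¹ := by
  rw [eq_inv_iff_mul_eq_one, ← circleLoc_mul, inv_mul_cancel, inv_mul_cancel, circleLoc_one]

/-- The WEYL ELEMENT `circleLoc 1 (−1) = !![0, 1; 1, 0]`. [cite: Knapp1986, VII §1] -/
theorem coe_circleLoc_weyl :
    (((circleLoc L w 1 (-1) : archLocal L 2 ((StdForm.antidiagonal 2).over L) w) : GL (Fin 2) ℂ) : Matrix (Fin 2) (Fin 2) ℂ) = !![(0 : ℂ), 1; 1, 0] := by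
  rw [coe_circleLoc, circleLocMatrix]
  ext i j
  fin_cases i <;> fin_cases j <;> simp

/-- **WEYL CONJUGATION ON THE TORUS**: `weyl · diag(e^u, e^{−u}) = diag(e^{−u}, e^u) · weyl`. [cite: Knapp1986, VII §1] -/
theorem circleLoc_weyl_mul_torusLoc (u : ℝ) : circleLoc L w 1 (-1) * torusLoc L w u = torusLoc L w (-u) * circleLoc L w 1 (-1) := by
  apply Subtype.ext
  apply Matrix.GeneralLinearGroup.ext
  intro i j
  change (circleLocMatrix 1 (-1) * torusLocMatrix u) i j = (torusLocMatrix (-u) * circleLocMatrix 1 (-1)) i j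
  rw [circleLocMatrix, torusLocMatrix, torusLocMatrix, neg_neg]
  fin_cases i <;> fin_cases j <;> simp [Matrix.mul_apply, Fin.sum_univ_two]

/-- `(u, v) ↦ circleLoc w u v` is continuous. [folklore] -/
theorem continuous_circleLoc : Continuous fun p : Circle × Circle => circleLoc L w p.1 p.2 := by
  refine Continuous.subtype_mk ?_ _
  refine Units.continuous_iff.2 ⟨?_, ?_⟩
  · refine continuous_matrix fun i j => ?_
    fin_cases i <;> fin_cases j <;> simp [circleLocMatrix] <;> fun_prop
  · have h : ∀ p : Circle × Circle, ((Matrix.GeneralLinearGroup.mkOfDetNeZero (circleLocMatrix p.1 p.2) (det_circleLocMatrix_ne_zero p.1 p.2))⁻¹ : GL (Fin 2) ℂ) =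
        Matrix.GeneralLinearGroup.mkOfDetNeZero (circleLocMatrix p.1⁻¹ p.2⁻¹) (det_circleLocMatrix_ne_zero p.1⁻¹ p.2⁻¹) := fun p => by
      have := circleLoc_inv L w p.1 p.2
      rw [Subtype.ext_iff, Subgroup.coe_inv] at this
      exact this.symm
    simp_rw [h]
    have hc1 : Continuous fun p : Circle × Circle => ((p.1 : ℂ))⁻¹ := (continuous_subtype_val.comp continuous_fst).inv₀ fun _ => Circle.coe_ne_zero _
    have hc2 : Continuous fun p : Circle × Circle => ((p.2 : ℂ))⁻¹ := (continuous_subtype_val.comp continuous_snd).inv₀ fun _ => Circle.coe_ne_zero _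
    refine continuous_matrix fun i j => ?_
    fin_cases i <;> fin_cases j <;> simp [circleLocMatrix] <;> fun_prop

/-- `θ ↦ circleLoc w 1 (e^{iθ})` is continuous (the one-parameter family of FILE (ii)'s average). [folklore] -/
theorem continuous_circleLoc_exp : Continuous fun θ : ℝ => circleLoc L w 1 (Circle.exp θ) := by
  refine Continuous.subtype_mk ?_ _
  refine Units.continuous_iff.2 ⟨?_, ?_⟩
  · refine continuous_matrix fun i j => ?_
    fin_cases i <;> fin_cases j <;> simp [circleLocMatrix] <;> fun_prop
  · have h : ∀ θ : ℝ, ((Matrix.GeneralLinearGroup.mkOfDetNeZero (circleLocMatrix 1 (Circle.exp θ)) (det_circleLocMatrix_ne_zero 1 (Circle.exp θ)))⁻¹ : GL (Fin 2) ℂ) =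
        Matrix.GeneralLinearGroup.mkOfDetNeZero (circleLocMatrix 1 (Circle.exp (-θ))) (det_circleLocMatrix_ne_zero 1 (Circle.exp (-θ))) := fun θ => by
      have := circleLoc_inv L w 1 (Circle.exp θ)
      rw [inv_one, ← Circle.exp_neg, Subtype.ext_iff, Subgroup.coe_inv] at this
      exact this.symm
    simp_rw [h]
    have hne : ∀ x : ℝ, Complex.exp ((x : ℂ) * Complex.I) ≠ 0 := fun x => Complex.exp_ne_zero _
    refine continuous_matrix fun i j => ?_
    fin_cases i <;> fin_cases j <;> simp [circleLocMatrix] <;> fun_prop (disch := exact hne _)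

/-! ## §2 The adelic families at the place `w` -/

variable [NumberField L] [IsCMField L]

/-- **`torusAt w a := ((diag(a, a⁻¹) at w, 1 elsewhere), 1_f) ∈ U(J₂)(𝔸_{L⁺})`** for `a > 0` (through `a = e^{log a}`; junk but well-defined for `a ≤ 0`) — the split archimedean torus at ONE
place along which the `hmc` matrix coefficient is read. [cite: BorelJacquet1979, §4.1] [cite: Knapp1986, VII §1] -/
def torusAt (a : ℝ) : (quasiSplit (↥(maximalRealSubfield L)) L (IsCMField.complexConj L) 2).Adelic :=
  adelicSingle (↥(maximalRealSubfield L)) L (IsCMField.complexConj L) 2 ((StdForm.antidiagonal 2).over L) (IsCMField.complexConj_ne_one L)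
    (complexConj_smul_infinitePlace L) w (torusLoc L w (Real.log a))

/-- **`circleAt w u v := ((circleLoc u v at w, 1 elsewhere), 1_f) ∈ U(J₂)(𝔸_{L⁺})`** (`u v : Circle`). [cite: BorelJacquet1979, §4.1] [cite: Garrett2018, §2.2] -/
def circleAt (u v : Circle) : (quasiSplit (↥(maximalRealSubfield L)) L (IsCMField.complexConj L) 2).Adelic :=
  adelicSingle (↥(maximalRealSubfield L)) L (IsCMField.complexConj L) 2 ((StdForm.antidiagonal 2).over L) (IsCMField.complexConj_ne_one L)
    (complexConj_smul_infinitePlace L) w (circleLoc L w u v)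

/-- Unfolding of `torusAt`. [folklore] -/
theorem torusAt_def (a : ℝ) : torusAt L w a = adelicSingle (↥(maximalRealSubfield L)) L (IsCMField.complexConj L) 2 ((StdForm.antidiagonal 2).over L)
    (IsCMField.complexConj_ne_one L) (complexConj_smul_infinitePlace L) w (torusLoc L w (Real.log a)) := rfl

/-- Unfolding of `circleAt`. [folklore] -/
theorem circleAt_def (u v : Circle) : circleAt L w u v = adelicSingle (↥(maximalRealSubfield L)) L (IsCMField.complexConj L) 2 ((StdForm.antidiagonal 2).over L)
    (IsCMField.complexConj_ne_one L) (complexConj_smul_infinitePlace L) w (circleLoc L w u v) := rfl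

/-- `torusAt 1 = 1`. [folklore] -/
theorem torusAt_one : torusAt L w 1 = 1 := by
  rw [torusAt_def, Real.log_one, torusLoc_zero, map_one]

/-- **`torusAt (a b) = torusAt a · torusAt b`** for `a, b > 0`. [cite: Knapp1986, VII §1] -/
theorem torusAt_mul {a b : ℝ} (ha : 0 < a) (hb : 0 < b) : torusAt L w (a * b) = torusAt L w a * torusAt L w b := by
  rw [torusAt_def, torusAt_def, torusAt_def, Real.log_mul ha.ne' hb.ne', torusLoc_add, map_mul]

/-- **`torusAt a⁻¹ = (torusAt a)⁻¹`** (the `ht` binder of ★ `arch_unitarity_of_matrixCoeff`; holds for every real `a` by `log a⁻¹ = −log a`). [cite: Knapp1986, VII §1] -/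
theorem torusAt_inv (a : ℝ) : torusAt L w a⁻¹ = (torusAt L w a)⁻¹ := by
  rw [torusAt_def, torusAt_def, Real.log_inv, torusLoc_neg, map_inv]

/-- `circleAt 1 1 = 1`. [folklore] -/
theorem circleAt_one : circleAt L w 1 1 = 1 := by
  rw [circleAt_def, circleLoc_one, map_one]

/-- **`circleAt (u u′) (v v′) = circleAt u v · circleAt u′ v′`.** [cite: Garrett2018, §2.2] -/
theorem circleAt_mul (u u' v v' : Circle) : circleAt L w (u * u') (v * v') = circleAt L w u v * circleAt L w u' v' := by
  rw [circleAt_def, circleAt_def, circleAt_def, circleLoc_mul, map_mul]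

/-- `circleAt u⁻¹ v⁻¹ = (circleAt u v)⁻¹`. [folklore] -/
theorem circleAt_inv (u v : Circle) : circleAt L w u⁻¹ v⁻¹ = (circleAt L w u v)⁻¹ := by
  rw [circleAt_def, circleAt_def, circleLoc_inv, map_inv]

/-- **WEYL CONJUGATION, adelic**: `circleAt 1 (−1) · torusAt a · (circleAt 1 (−1))⁻¹ = torusAt a⁻¹` (the Weyl symmetry `Φ(a⁻¹) = Φ(a)` of the matrix coefficient, ★ `archTorusCoeff_inv`, on the
group side). [cite: Knapp1986, VII §1] -/
theorem circleAt_weyl_conj_torusAt (a : ℝ) : circleAt L w 1 (-1) * torusAt L w a * (circleAt L w 1 (-1))⁻¹ = torusAt L w a⁻¹ := by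
  rw [circleAt_def, torusAt_def, torusAt_def, ← map_mul, circleLoc_weyl_mul_torusLoc, map_mul, mul_inv_cancel_right, Real.log_inv]

/-- `a ↦ torusAt w a` is continuous on `(0, ∞)`. [folklore] -/
theorem continuousOn_torusAt : ContinuousOn (torusAt L w) (Set.Ioi 0) := by
  refine ((continuous_adelicSingle (↥(maximalRealSubfield L)) L (IsCMField.complexConj L) 2 ((StdForm.antidiagonal 2).over L) (IsCMField.complexConj_ne_one L)
    (complexConj_smul_infinitePlace L) w).comp (continuous_torusLoc L w)).comp_continuousOn ?_
  exact Real.continuousOn_log.mono fun a ha => ne_of_gt ha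

/-- `(u, v) ↦ circleAt w u v` is continuous. [folklore] -/
theorem continuous_circleAt : Continuous fun p : Circle × Circle => circleAt L w p.1 p.2 :=
  (continuous_adelicSingle (↥(maximalRealSubfield L)) L (IsCMField.complexConj L) 2 ((StdForm.antidiagonal 2).over L) (IsCMField.complexConj_ne_one L)
    (complexConj_smul_infinitePlace L) w).comp (continuous_circleLoc L w)

/-- `θ ↦ circleAt w 1 (e^{iθ})` is continuous (the one-parameter family of FILE (ii)'s average). [folklore] -/
theorem continuous_circleAt_exp : Continuous fun θ : ℝ => circleAt L w 1 (Circle.exp θ) :=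
  (continuous_adelicSingle (↥(maximalRealSubfield L)) L (IsCMField.complexConj L) 2 ((StdForm.antidiagonal 2).over L) (IsCMField.complexConj_ne_one L)
    (complexConj_smul_infinitePlace L) w).comp (continuous_circleLoc_exp L w)

end Summit.HodgeConjecture.HodgeConjecture.Cruxes.H413.K2E1ArchTorusFamilyU11Defs

end
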